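/-
Copyright (c) 2026. All rights reserved.
Released under Apache 2.0 license as described in the file LICENSE.
Authors: abc-iut cell — seat abc-iut-L4-t8 (wave 2, L4 discharge; proof-only companion of
`HolomorphicCores.lean`, typed by abc-iut-L4-t2 / abc-iut-L4-t14).
-/
import Literature.AnabelianGeometry.AbsoluteAnabelian.HolomorphicCores

/-!
# Proof-only companion of `HolomorphicCores`: the orbispace clause of [AbsTopIII] Cor 2.4 (c)

S. Mochizuki, *Topics in absolute anabelian geometry III*, Cor 2.4 (c) (kurims p.55): for a
hyperbolic Riemann surface `X` of finite type with universal covering `U → X` and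
`π₁(X^top) = Aut(U^top/X^top) ↪ Aut⁰(𝕌)`, the commensurator `Π` of the image of `π₁(X^top)` acts on
`U^top` so that the "orbispace quotient" `[𝕌/Π]` makes sense.  The statement file records this as
the named `Prop` fact `HyperbolicCoreOrbispace` (arithmeticity itself being the DEFINITION
`IsMargulisNonArithmetic`): the commensurator acts PROPERLY DISCONTINUOUSLY with FINITE
stabilisers by automorphisms of `𝕌`.

We PROVE it (`HyperbolicCoreOrbispace_holds`), unconditionally, by classical covering-space
topology — no uniformisation, no `PSL₂(ℝ)`:

* `deck_subsingleton_nhds` — for a covering map `f : E → X` with `X` Hausdorff and locally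
  connected and `E` connected, any two points `u, u' ∈ E` have neighbourhoods `V ∋ u`, `V' ∋ u'`
  met by AT MOST ONE deck transformation (`γ V ∩ V' ≠ ∅` for at most one `γ`): distinct fibres are
  separated downstairs; in one fibre, a deck transformation carries the connected sheet of `u` into
  a single sheet, and two deck transformations agreeing at a point are equal (uniqueness of lifts,
  the tree's `deck_eq_of_apply_eq`, Hatcher Prop. 1.34);
* `finite_deck_inter_of_isCompact` — hence `{γ ∈ Aut(E/X) | γ K ∩ L ≠ ∅}` is finite for compact
  `K, L ⊆ E` (finite subcover of `K × L`): the deck group acts properly discontinuously;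
* `finite_inter_of_finite_cosets` — a set of homeomorphisms covered by finitely many left
  translates `γᵢ · Aut(E/X)` still has this property; a subgroup in which the deck group has finite
  index (`relIndex ≠ 0`, as in `IsMargulisNonArithmetic`) is so covered;
* finite stabilisers are the case `K = L = {x}`, and `Aut⁰(𝕌) ⊆ Aut(𝕌)` holds by construction of
  `autIdComponent` as a connected component of `autSet`.

The hypotheses "of finite type", "surjective", "holomorphic", "Aut-holomorphic disc" of the typed
fact are not needed for this clause and are not used (the statement is proved as typed, for every
instance of its binders).  Refereed pre-IUT material; nothing here bears on the disputed
[IUTchIII] Cor. 3.12; no side is taken.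
-/

namespace Literature.AnabelianGeometry.AbsoluteAnabelian

open _root_.TopologicalSpace _root_.Topology _root_.Set
open scoped Pointwise
open Literature.Geometry.Kaehler.ComplexTorus (deckTransformations mem_deckTransformations_iff
  deck_eq_of_apply_eq)

universe u

/-! ### Covering-space topology: the deck group acts properly discontinuously -/

section DeckGroup

variable {E : Type*} [TopologicalSpace E] {X : Type*} [TopologicalSpace X] {f : E → X}

/-- **Sheets over a connected evenly covered neighbourhood.**  For a covering map `f : E → X` with
locally connected base and two points `u, u'` of the same fibre there are: a preconnected open
`V ∋ u`, an open `V' ∋ u'` on which `f` is injective, and an open `V''` disjoint from `V'` such that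
`f ⁻¹' (f '' V) ⊆ V' ∪ V''` — i.e. `V` is the sheet of `u` and `V'` the sheet of `u'` over one
connected evenly covered open `W`, `V''` the union of the other sheets over `W`.
[cite: HatcherAT2002, §1.3 "Deck Transformations and Group Actions"] -/
theorem exists_sheets_of_apply_eq (hf : IsCoveringMap f) [LocallyConnectedSpace X] {u u' : E}
    (huu' : f u = f u') :
    ∃ (W : Set X) (V V' V'' : Set E), IsOpen V ∧ u ∈ V ∧ IsPreconnected V ∧ V ⊆ f ⁻¹' W ∧
      IsOpen V' ∧ u' ∈ V' ∧ InjOn f V' ∧ IsOpen V'' ∧ Disjoint V' V'' ∧ f ⁻¹' W ⊆ V' ∪ V'' := by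
  obtain ⟨hI, U, hxU, hUo, hfU, H, hH⟩ := hf (f u)
  obtain ⟨W, hWU, hWo, hxW, hWc⟩ :=
    locallyConnectedSpace_iff_subsets_isOpen_isConnected.mp ‹_› (f u) U (hUo.mem_nhds hxU)
  -- the sheets over `W`, as subsets of `E`, indexed by subsets of the fibre
  let sheet : Set (f ⁻¹' {f u}) → Set E :=
    fun S => Subtype.val '' (H ⁻¹' ((Subtype.val ⁻¹' W) ×ˢ S))
  have hval : IsOpenMap (Subtype.val : f ⁻¹' U → E) := hfU.isOpenMap_subtype_val
  have hWo' : IsOpen (Subtype.val ⁻¹' W : Set U) := hWo.preimage continuous_subtype_val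
  have hsheet_open : ∀ S, IsOpen (sheet S) := fun S =>
    hval _ ((hWo'.prod (isOpen_discrete S)).preimage H.continuous)
  have hmem_sheet : ∀ (S) (e : E) (he : f e ∈ U),
      e ∈ sheet S ↔ f e ∈ W ∧ (H ⟨e, he⟩).2 ∈ S := by
    intro S e he
    constructor
    · rintro ⟨t, ht, rfl⟩
      rcases ht with ⟨h1, h2⟩
      refine ⟨?_, h2⟩
      have := hH t
      rw [Set.mem_preimage] at h1
      rwa [this] at h1
    · rintro ⟨h1, h2⟩
      refine ⟨⟨e, he⟩, ⟨?_, h2⟩, rfl⟩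
      show ((H ⟨e, he⟩).1 : X) ∈ W
      rwa [hH]
  have hsheet_sub : ∀ S, sheet S ⊆ f ⁻¹' W := by
    rintro S e ⟨t, ⟨h1, -⟩, rfl⟩
    have := hH t
    show f t ∈ W
    rw [← this]; exact h1
  have huU : f u ∈ U := hxU
  have hu'U : f u' ∈ U := huu' ▸ hxU
  refine ⟨W, sheet {(H ⟨u, huU⟩).2}, sheet {(H ⟨u', hu'U⟩).2}, sheet {(H ⟨u', hu'U⟩).2}ᶜ,
    hsheet_open _, (hmem_sheet _ u huU).2 ⟨hxW, rfl⟩, ?_, hsheet_sub _,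
    hsheet_open _, (hmem_sheet _ u' hu'U).2 ⟨huu' ▸ hxW, rfl⟩, ?_, hsheet_open _, ?_, ?_⟩
  · -- the sheet of `u` is preconnected: it is the homeomorphic image of `W`
    have hWpre : IsPreconnected (Subtype.val ⁻¹' W : Set U) := by
      rw [← Topology.IsInducing.subtypeVal.isPreconnected_image]
      have : Subtype.val '' (Subtype.val ⁻¹' W : Set U) = W := by
        rw [Subtype.image_preimage_coe, Set.inter_eq_right.2 hWU]
      rw [this]; exact hWc.isPreconnected
    have h1 : IsPreconnected ((Subtype.val ⁻¹' W : Set U) ×ˢ ({(H ⟨u, huU⟩).2} : Set _)) :=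
      hWpre.prod isPreconnected_singleton
    have h2 := h1.image H.symm H.symm.continuous.continuousOn
    rw [Homeomorph.image_symm] at h2
    exact h2.image _ continuous_subtype_val.continuousOn
  · -- `f` is injective on a single sheet
    rintro e₁ ⟨t₁, ⟨h1, h1'⟩, rfl⟩ e₂ ⟨t₂, ⟨h2, h2'⟩, rfl⟩ heq
    have key : H t₁ = H t₂ := by
      refine Prod.ext (Subtype.ext ?_) ?_
      · rw [hH, hH]; exact heq
      · rw [Set.mem_singleton_iff.1 h1', Set.mem_singleton_iff.1 h2']
    rw [H.injective key]
  · -- distinct sheets are disjoint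
    refine Set.disjoint_left.2 ?_
    rintro e ⟨t₁, ⟨-, h1'⟩, rfl⟩ ⟨t₂, ⟨-, h2'⟩, ht⟩
    have : t₂ = t₁ := Subtype.ext ht
    subst this
    exact h2' h1'
  · -- the sheets cover `f ⁻¹' W`
    intro e he
    have heU : f e ∈ U := hWU he
    by_cases h : (H ⟨e, heU⟩).2 = (H ⟨u', hu'U⟩).2
    · exact Or.inl ((hmem_sheet _ e heU).2 ⟨he, h⟩)
    · exact Or.inr ((hmem_sheet _ e heU).2 ⟨he, h⟩)

/-- **At most one deck transformation near a pair of points.**  For a covering map `f : E → X`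
with `X` Hausdorff and locally connected and `E` connected, any `u, u' ∈ E` have open
neighbourhoods `V ∋ u`, `V' ∋ u'` such that at most one deck transformation `γ` satisfies
`γ V ∩ V' ≠ ∅`.
[cite: HatcherAT2002, §1.3 "Deck Transformations and Group Actions"] -/
theorem deck_subsingleton_nhds (hf : IsCoveringMap f) [T2Space X] [LocallyConnectedSpace X]
    [PreconnectedSpace E] (u u' : E) :
    ∃ V V' : Set E, IsOpen V ∧ u ∈ V ∧ IsOpen V' ∧ u' ∈ V' ∧
      {γ : E ≃ₜ E | γ ∈ deckTransformations f ∧ (γ '' V ∩ V').Nonempty}.Subsingleton := by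
  by_cases huu' : f u = f u'
  · obtain ⟨W, V, V', V'', hVo, huV, hVc, hVW, hV'o, hu'V', hinj, hV''o, hdisj, hcov⟩ :=
      exists_sheets_of_apply_eq hf huu'
    refine ⟨V, V', hVo, huV, hV'o, hu'V', ?_⟩
    -- a deck transformation meeting `V'` from `V` carries all of `V` into `V'`
    have whole : ∀ γ : E ≃ₜ E, γ ∈ deckTransformations f → (γ '' V ∩ V').Nonempty →
        V ⊆ γ ⁻¹' V' := by
      intro γ hγ hne
      have hsub : V ⊆ γ ⁻¹' V' ∪ γ ⁻¹' V'' := by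
        intro v hv
        have : γ v ∈ f ⁻¹' W := by
          show f (γ v) ∈ W
          rw [(mem_deckTransformations_iff f γ).1 hγ v]; exact hVW hv
        exact hcov this
      rcases hVc.subset_or_subset (hV'o.preimage γ.continuous) (hV''o.preimage γ.continuous)
        (hdisj.preimage γ) hsub with h | h
      · exact h
      · exfalso
        obtain ⟨_, ⟨v, hv, rfl⟩, hv'⟩ := hne
        exact Set.disjoint_left.1 hdisj hv' (h hv)
    intro γ₁ ⟨hγ₁, hne₁⟩ γ₂ ⟨hγ₂, hne₂⟩
    obtain ⟨_, ⟨v, hv, rfl⟩, hv'⟩ := hne₁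
    have h₂ : γ₂ v ∈ V' := whole γ₂ hγ₂ hne₂ hv
    have : γ₁ v = γ₂ v := hinj hv' h₂ (by
      rw [(mem_deckTransformations_iff f γ₁).1 hγ₁ v, (mem_deckTransformations_iff f γ₂).1 hγ₂ v])
    exact deck_eq_of_apply_eq hf hγ₁ hγ₂ this
  · -- distinct fibres: separate downstairs
    obtain ⟨O, O', hO, hO', hxO, hxO', hOO'⟩ := t2_separation huu'
    refine ⟨f ⁻¹' O, f ⁻¹' O', hO.preimage hf.continuous, hxO, hO'.preimage hf.continuous, hxO',
      ?_⟩
    intro γ₁ ⟨hγ₁, hne₁⟩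
    exfalso
    obtain ⟨_, ⟨v, hv, rfl⟩, hv'⟩ := hne₁
    refine Set.disjoint_left.1 hOO' ?_ hv'
    show f (γ₁ v) ∈ O
    rw [(mem_deckTransformations_iff f γ₁).1 hγ₁ v]; exact hv

/-- **The deck group acts properly discontinuously.**  For a covering map `f : E → X` with `X`
Hausdorff and locally connected and `E` connected, only finitely many deck transformations `γ`
satisfy `γ K ∩ L ≠ ∅`, for any compact `K, L ⊆ E`.
[cite: HatcherAT2002, §1.3 "Deck Transformations and Group Actions"] -/
theorem finite_deck_inter_of_isCompact (hf : IsCoveringMap f) [T2Space X]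
    [LocallyConnectedSpace X] [PreconnectedSpace E] {K L : Set E} (hK : IsCompact K)
    (hL : IsCompact L) :
    {γ : E ≃ₜ E | γ ∈ deckTransformations f ∧ (γ '' K ∩ L).Nonempty}.Finite := by
  choose V V' hVo huV hV'o hu'V' hsub using deck_subsingleton_nhds hf
  obtain ⟨t, ht⟩ := (hK.prod hL).elim_finite_subcover (fun q : E × E => V q.1 q.2 ×ˢ V' q.1 q.2)
    (fun q => (hVo q.1 q.2).prod (hV'o q.1 q.2))
    (fun q hq => Set.mem_iUnion.2 ⟨q, ⟨huV q.1 q.2, hu'V' q.1 q.2⟩⟩)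
  refine ((t.finite_toSet).biUnion fun q _ => (hsub q.1 q.2).finite).subset ?_
  rintro γ ⟨hγ, ⟨_, ⟨k, hk, rfl⟩, hl⟩⟩
  have := ht (Set.mk_mem_prod hk hl)
  simp only [Set.mem_iUnion] at this
  obtain ⟨q, hq, hkq⟩ := this
  exact Set.mem_biUnion hq ⟨hγ, ⟨γ k, ⟨k, hkq.1, rfl⟩, hkq.2⟩⟩

/-- **Finite stabilisers** (indeed trivial ones, but finiteness is what the orbispace clause asks):
the case `K = L = {x}` of `finite_deck_inter_of_isCompact`, stated for any set `P` of
homeomorphisms enjoying the compact-set finiteness property. [folklore] -/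
private theorem finite_stabilizer_of_finite_inter {P : Set (E ≃ₜ E)}
    (h : ∀ K L : Set E, IsCompact K → IsCompact L →
      {γ : E ≃ₜ E | γ ∈ P ∧ (γ '' K ∩ L).Nonempty}.Finite) (x : E) :
    {γ : E ≃ₜ E | γ ∈ P ∧ γ x = x}.Finite :=
  (h {x} {x} isCompact_singleton isCompact_singleton).subset fun _ ⟨hγ, hx⟩ =>
    ⟨hγ, ⟨x, ⟨x, rfl, hx⟩, rfl⟩⟩

/-- **Finitely many translates.**  If every element of `P` lies in one of finitely many left
translates `tᵢ · D` of a set `D` of homeomorphisms with the compact-set finiteness property, then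
`P` has the property too (`(tᵢ δ) K ∩ L ≠ ∅ ⟺ δ K ∩ tᵢ⁻¹ L ≠ ∅`). [folklore] -/
private theorem finite_inter_of_finite_cosets {D P : Set (E ≃ₜ E)}
    (hD : ∀ K L : Set E, IsCompact K → IsCompact L →
      {γ : E ≃ₜ E | γ ∈ D ∧ (γ '' K ∩ L).Nonempty}.Finite)
    {ι : Type*} [Finite ι] (t : ι → E ≃ₜ E) (hP : ∀ γ ∈ P, ∃ i, (t i)⁻¹ * γ ∈ D)
    {K L : Set E} (hK : IsCompact K) (hL : IsCompact L) :
    {γ : E ≃ₜ E | γ ∈ P ∧ (γ '' K ∩ L).Nonempty}.Finite := by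
  refine (Set.finite_iUnion fun i =>
    ((hD K (((t i)⁻¹ : E ≃ₜ E) '' L) hK (hL.image ((t i)⁻¹ : E ≃ₜ E).continuous)).image
    fun δ => t i * δ)).subset ?_
  rintro γ ⟨hγ, ⟨_, ⟨k, hk, rfl⟩, hl⟩⟩
  obtain ⟨i, hi⟩ := hP γ hγ
  refine Set.mem_iUnion.2 ⟨i, ⟨(t i)⁻¹ * γ, ⟨hi, ⟨((t i)⁻¹ * γ) k, ⟨k, hk, rfl⟩, ?_⟩⟩, ?_⟩⟩
  · exact ⟨γ k, hl, rfl⟩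
  · simp only [mul_inv_cancel_left]

end DeckGroup

/-! ### Group theory: finite index gives finitely many translates -/

section FiniteIndex

universe v

variable {A : Type v} [Group A]

/-- A subgroup lies in its own commensurator. [folklore] -/
private theorem le_commensurator (H : Subgroup A) :
    H ≤ Subgroup.Commensurable.commensurator H := by
  intro h hh
  rw [Subgroup.Commensurable.commensurator_mem_iff]
  have : ConjAct.toConjAct h • H = H := by
    ext x
    rw [Subgroup.mem_pointwise_smul_iff_inv_smul_mem, ← ConjAct.toConjAct_inv,
      ConjAct.toConjAct_smul, inv_inv]
    constructor
    · intro hx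
      have := H.mul_mem (H.mul_mem hh hx) (H.inv_mem hh)
      simpa only [mul_assoc, mul_inv_cancel, mul_one, mul_inv_cancel_left] using this
    · intro hx
      exact H.mul_mem (H.mul_mem (H.inv_mem hh) hx) hh
  rw [this]

/-- If `D ≤ C` has finite index in `C` (`D.relIndex C ≠ 0`), every element of `C` lies in one of
finitely many left translates of `D`, indexed by the finite quotient `C ⧸ (D ∩ C)`. [folklore] -/
private theorem exists_finite_translates_of_relIndex_ne_zero {D C : Subgroup A}
    (h : D.relIndex C ≠ 0) :
    ∃ (ι : Type v) (_ : Finite ι) (t : ι → A), (∀ i, t i ∈ C) ∧ ∀ γ ∈ C, ∃ i, (t i)⁻¹ * γ ∈ D := by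
  have hfin : (D.subgroupOf C).FiniteIndex := Subgroup.finiteIndex_iff.2 h
  refine ⟨↥C ⧸ D.subgroupOf C, inferInstance, fun q => ((Quotient.out q : C) : A),
    fun q => (Quotient.out q).2, ?_⟩
  intro γ hγ
  refine ⟨QuotientGroup.mk (⟨γ, hγ⟩ : C), ?_⟩
  obtain ⟨d, hd⟩ := QuotientGroup.mk_out_eq_mul (D.subgroupOf C) (⟨γ, hγ⟩ : C)
  dsimp only
  rw [hd]
  have hdD : ((d : C) : A) ∈ D := by
    have := d.2
    rwa [Subgroup.mem_subgroupOf] at this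
  simpa [Subgroup.coe_mul, mul_inv_rev, mul_assoc] using D.inv_mem hdD

end FiniteIndex

/-! ### The discharge -/

/-- `Aut⁰(𝕌) ⊆ Aut(𝕌)`: the identity component is, by construction, a subset of `autSet`.
[cite: MochizukiAbsTopIII2015, Corollary 2.4 (b) p.54] -/
theorem autIdComponent_subset_autSet {Ucov : Type u} [TopologicalSpace Ucov]
    (AU : AutHolStructure Ucov) : autIdComponent AU ⊆ autSet AU := by
  rintro _ ⟨γ, -, rfl⟩
  exact γ.2

/-- **[AbsTopIII] Cor 2.4 (c), orbispace clause — DISCHARGED.**  The named fact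
`HyperbolicCoreOrbispace` of `HolomorphicCores.lean` HOLDS: for a covering `p : U → X` of a
Hausdorff Riemann surface by a simply connected `U` and `G = Aut⁰(𝕌)` with
`π₁(X^top) = Aut(U^top/X^top) ≤ G` of finite index in its commensurator in `G` (the typed
`IsMargulisNonArithmetic`), the commensurator `Π` acts on `U^top` properly discontinuously
(`{γ ∈ Π | γ K ∩ L ≠ ∅}` finite for compact `K, L`), with finite stabilisers, by elements of
`Aut(𝕌)`.
Proof: the deck group acts properly discontinuously (`finite_deck_inter_of_isCompact`: `X` is
locally connected as a manifold over `ℂ`, `U` is connected as a simply connected space), a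
finite-index overgroup inherits this (`finite_inter_of_finite_cosets`,
`exists_finite_translates_of_relIndex_ne_zero`), stabilisers are the case `K = L = {x}`, and
`Π ≤ G = Aut⁰(𝕌) ⊆ Aut(𝕌)`.  The remaining hypotheses of the typed fact (finite type, surjective,
holomorphic, Aut-holomorphic disc) are not used.
[cite: MochizukiAbsTopIII2015, Corollary 2.4 (c) p.55] -/
theorem HyperbolicCoreOrbispace_holds : HyperbolicCoreOrbispace := by
  intro X _ _ _ _ Ucov _ _ _ _ p _ hp _ _ _ G hG hM
  -- `X` is locally connected (charts in `ℂ`), `Ucov` is (path) connected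
  have : LocallyConnectedSpace X := ChartedSpace.locallyConnectedSpace ℂ X
  set D : Subgroup (Ucov ≃ₜ Ucov) := deckGroup p with hDdef
  set C : Subgroup G := Subgroup.Commensurable.commensurator (D.subgroupOf G) with hCdef
  set Pc : Subgroup (Ucov ≃ₜ Ucov) := C.map G.subtype with hPc
  obtain ⟨hDG, hidx⟩ := hM
  -- properly discontinuous action of the deck group
  have hD : ∀ K L : Set Ucov, IsCompact K → IsCompact L →
      {γ : Ucov ≃ₜ Ucov | γ ∈ (D : Set (Ucov ≃ₜ Ucov)) ∧ (γ '' K ∩ L).Nonempty}.Finite :=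
    fun K L hK hL => finite_deck_inter_of_isCompact hp hK hL
  -- finitely many translates of `D` cover `Pc`
  obtain ⟨ι, hι, t, htC, ht⟩ := exists_finite_translates_of_relIndex_ne_zero hidx
  have hcov : ∀ γ ∈ (Pc : Set (Ucov ≃ₜ Ucov)), ∃ i, ((t i : G) : Ucov ≃ₜ Ucov)⁻¹ * γ ∈
      (D : Set (Ucov ≃ₜ Ucov)) := by
    rintro γ ⟨c, hc, rfl⟩
    obtain ⟨i, hi⟩ := ht c hc
    refine ⟨i, ?_⟩
    rw [Subgroup.mem_subgroupOf] at hi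
    simpa using hi
  have hPD : ∀ K L : Set Ucov, IsCompact K → IsCompact L →
      {γ : Ucov ≃ₜ Ucov | γ ∈ (Pc : Set (Ucov ≃ₜ Ucov)) ∧ (γ '' K ∩ L).Nonempty}.Finite :=
    fun K L hK hL =>
      finite_inter_of_finite_cosets hD (fun i => ((t i : G) : Ucov ≃ₜ Ucov)) hcov hK hL
  refine ⟨hPD, finite_stabilizer_of_finite_inter hPD, ?_⟩
  -- `Pc ≤ G = Aut⁰(𝕌) ⊆ Aut(𝕌)`
  rintro γ ⟨c, -, rfl⟩
  have : (G.subtype c : Ucov ≃ₜ Ucov) ∈ (G : Set (Ucov ≃ₜ Ucov)) := c.2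
  rw [hG] at this
  exact autIdComponent_subset_autSet _ this

end Literature.AnabelianGeometry.AbsoluteAnabelian
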